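import Literature.Computability.QuantumComplexity.SimTokens
import Literature.Computability.Complexity.GenPrograms
import Mathlib.Algebra.Polynomial.Eval.Degree
import HarnessLib

/-!
# Uniformity of the `BPP ⊆ BQP` simulation family, and `BPP ⊆ BQP`

The circuit family of `ReversibleSimulation.lean` — Hadamard coins followed by the Clifford+T
compilation of the reversible tableau program `prog M n (p n) (T n)` — is **polynomial-time
uniform**: its description `1ⁿ ↦ sigmaEncode ⟨n, m n, Cₙ⟩` is computable in polynomial time
(`P`-uniform, Arora–Barak 2009, Def. 6.12; for the tableau circuit this is their Remark 6.7:
"The circuit is not only of polynomial size but can also be computed in polynomial time";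
Bernstein–Vazirani 1997, proof of Thm. 8.3: dovetailing "gives a polynomial time QTM"). With
the generic engine of `GenPrograms.lean` (nested counted loops over unary counters
run in polynomial time on Mathlib's `TM2` model, `GStmt.out_mem_FP`), the renderer of
`TokenStreams.lean` (binary numerals of unary counters, `GStmt.render_out_mem_FP`) and the
description streams of `QuantumCircuitTokens.lean` (`QCircuitFamily.isUniform_of_gen`), the
proof is a *pure stream identity*: a generator
program `SimGen.gen M c k p : GStmt SVar Tok` — the header, a loop over the coins (Hadamard
records), the initialisation of block `0` (`NOT`s and `CNOT`s, by segments of the input stack: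
doubled input bits, separator, coins, empty cells; `SimTokens.flatMap_initNots`,
`flatMap_initCnots`), a loop over the steps of the tableau (for every pattern the minterm chain
and the controlled writes, with an inner loop over the shifted cells) and the final swap, all
wire numerals being polynomial expressions (`GExpr`) in `n` and the loop indices — generates
exactly the token stream `descTok` of the family (`SimGen.out_gen`); its loop indices are
`Z, J, I, TT`, never nested twice (`SimGen.gok_gen`).

Main results:

* `simFamily_isUniform_holds : simFamily_isUniform` (the named fact of
  `ReversibleSimulation.lean`);
* `uniformReversibleSimulation_holds : uniformReversibleSimulation` (the named fact of
  `BQPProofs.lean`, the reversible core of `BPP ⊆ BQP`), by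
  `uniformReversibleSimulation_of_isUniform`;
* `BPP_subset_BQP_holds : BPP_subset_BQP` (the named fact of `BQP.lean`; Bernstein–Vazirani
  1997, Thm. 8.3; Arora–Barak 2009, Cor. 10.11), by
  `BPP_subset_BQP_of_uniformReversibleSimulation`.

Relation to the tree: `RevTableauUniform.lean` proves the uniformity of the coin-free family
`RevSim.revFamily` (`P ⊆ EQP`) by the same route (a `GStmt` generator, `TokenStreams`
rendering, `QCircuitFamily.isUniform_of_mem_FP`); its generator prints the `ℕ`-wired layout of
`RevTableau.lean` and cannot be reused for the register layout of `ReversibleSimulation.lean`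
(coins, `boolPair` initialisation of block `0`, typed wires numbered by `WM.eT`/`eIdx`), so this
file mirrors *that* program instead. The small generic `GStmt` bookkeeping used here (`seqs`,
the loop-index discipline `GOK`) is kept local to the construction (namespace `BPPSim.SimGen`).

## References

* S. Arora, B. Barak, *Computational Complexity: A Modern Approach*, CUP 2009, Thm. 6.6,
  Remark 6.7, Def. 6.12, Thm. 6.13, Lemma 10.10, Cor. 10.11.
* E. Bernstein, U. Vazirani, *Quantum complexity theory*, SIAM J. Comput. 26 (1997),
  Thm. 8.3.
-/

noncomputable section

namespace Literature.Computability.QuantumComplexity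

open _root_.Computability Complexity Cryptography Polynomial

attribute [local instance] Turing.FinTM2.kFin Turing.FinTM2.ΛFin Turing.FinTM2.σFin

namespace BPPSim

/-! ### Variables, statement builders -/

/-- The counter variables of the generator: the input length, the numeral digit counter,
two cell/coin indices and the step index. [folklore] -/
inductive SVar
  | N0 | Z | J | I | TT
  deriving DecidableEq, Fintype

/-- Expressions of the generator. [folklore] -/
abbrev SimExpr : Type := GExpr SVar
/-- Statements of the generator. [folklore] -/
abbrev SimStmt : Type := GStmt SVar Tok

namespace SimGen

open Complexity.GExpr Complexity.GStmt

/-- Sequence of a list of statements. [folklore] -/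
def seqs : List SimStmt → SimStmt
  | [] => GStmt.emit []
  | s :: ss => GStmt.seq s (seqs ss)

/-- `seqs` generates the concatenation of the streams. [folklore] -/
@[simp] theorem out_seqs (l : List SimStmt) (env : SVar → ℕ) :
    (seqs l).out env = l.flatMap fun s => s.out env := by
  induction l with
  | nil => rfl
  | cons s l ih => simp [seqs, GStmt.out, ih]

/-- The loop indices of `seqs`. [folklore] -/
theorem loopVars_seqs (l : List SimStmt) : (seqs l).loopVars = l.flatMap GStmt.loopVars := by
  induction l with
  | nil => rfl
  | cons s l ih => simp [seqs, GStmt.loopVars, ih]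

/-- `seqs` reuses no index if no member does. [folklore] -/
theorem noReuse_seqs (l : List SimStmt) : (seqs l).noReuse = l.all GStmt.noReuse := by
  induction l with
  | nil => rfl
  | cons s l ih => simp [seqs, GStmt.noReuse, ih]

/-! #### Loop-index discipline -/

/-- A statement is *good for the index set `A`*: no nested reuse, loop indices in `A`.
[folklore] -/
def GOK (A : List SVar) (s : SimStmt) : Prop := s.noReuse = true ∧ ∀ x ∈ s.loopVars, x ∈ A

/-- Emissions are good for every index set. [folklore] -/
theorem gok_emit (A : List SVar) (ts : List Tok) : GOK A (GStmt.emit ts) :=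
  ⟨rfl, fun x hx => by simp [GStmt.loopVars] at hx⟩

/-- Sequences of good statements are good. [folklore] -/
theorem gok_seq {A : List SVar} {a b : SimStmt} (ha : GOK A a) (hb : GOK A b) : GOK A (GStmt.seq a b) :=
  ⟨by simp [GStmt.noReuse, ha.1, hb.1], fun x hx => by
    simp only [GStmt.loopVars, List.mem_append] at hx
    exact hx.elim (ha.2 x) (hb.2 x)⟩

/-- `seqs` of good statements is good. [folklore] -/
theorem gok_seqs {A : List SVar} {l : List SimStmt} (h : ∀ s ∈ l, GOK A s) : GOK A (seqs l) := by
  induction l with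
  | nil => exact gok_emit A []
  | cons s l ih =>
    exact gok_seq (h s (by simp)) (ih fun s' hs' => h s' (by simp [hs']))

/-- A loop with a fresh index over a good body is good. [folklore] -/
theorem gok_loop {A B : List SVar} {i : SVar} {e : SimExpr} {b : SimStmt} (hb : GOK B b) (hi : i ∉ B)
    (hBA : ∀ x ∈ B, x ∈ A) (hiA : i ∈ A) : GOK A (GStmt.loop i e b) :=
  ⟨by
    simp only [GStmt.noReuse, Bool.and_eq_true, decide_eq_true_eq]
    exact ⟨fun h => hi (hb.2 i h), hb.1⟩,
   fun x hx => by
    simp only [GStmt.loopVars, List.mem_cons] at hx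
    rcases hx with rfl | hx
    · exact hiA
    · exact hBA x (hb.2 x hx)⟩

/-- Goodness is monotone in the index set. [folklore] -/
theorem gok_mono {A B : List SVar} {s : SimStmt} (h : GOK A s) (hAB : ∀ x ∈ A, x ∈ B) : GOK B s :=
  ⟨h.1, fun x hx => hAB x (h.2 x hx)⟩

/-- Conditionals of good statements are good. [folklore] -/
theorem gok_ite {A : List SVar} {c : Prop} [Decidable c] {a b : SimStmt} (ha : GOK A a) (hb : GOK A b) :
    GOK A (if c then a else b) := by
  split <;> assumption

/-! #### Numerals and gate records -/

/-- The numeral `one^e bin q`. [folklore] -/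
def numS (e : SimExpr) (q : Bool) : SimStmt :=
  GStmt.seq (GStmt.loop SVar.Z e (GStmt.emit [Tok.tick])) (GStmt.emit [Tok.dump q true])

/-- `numS e q` generates the unary numeral of the value of `e`. [folklore] -/
@[simp] theorem out_numS (e : SimExpr) (q : Bool) (env : SVar → ℕ) :
    (numS e q).out env = unaryTok (e.eval env) q := by
  simp only [numS, GStmt.out, unaryTok]
  rw [range_flatMap_const]
  congr 1
  generalize e.eval env = v
  induction v with
  | zero => rfl
  | succ v ih => simp [List.replicate_succ, ih]

/-- `numS` uses the index `Z` only. [folklore] -/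
theorem gok_numS (e : SimExpr) (q : Bool) : GOK [SVar.Z] (numS e q) :=
  gok_seq (gok_loop (B := []) (gok_emit _ _) (by simp) (by simp) (by simp)) (gok_emit _ _)

/-- The record of a one-wire gate with symbol code `s` on the wire `w`. [cite: AroraBarakCC2009, §6.1] -/
def g1S (s : ℕ) (w : SimExpr) : SimStmt :=
  seqs [GStmt.emit (lits [false, false] ++ unaryTok s true ++ sep2 ++ lits (List.replicate 4 true) ++ sep2),
    numS w true, GStmt.emit (sep2 ++ lits [false, true])]

/-- `g1S` generates the record of a one-wire gate. [folklore] -/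
@[simp] theorem out_g1S (s : ℕ) (w : SimExpr) (env : SVar → ℕ) :
    (g1S s w).out env = gate1Tok s (w.eval env) := by
  simp [g1S, gate1Tok, GStmt.out, List.append_assoc]

/-- `g1S` uses the index `Z` only. [folklore] -/
theorem gok_g1S (s : ℕ) (w : SimExpr) : GOK [SVar.Z] (g1S s w) :=
  gok_seqs fun x hx => by
    simp only [List.mem_cons, List.not_mem_nil, or_false] at hx
    rcases hx with rfl | rfl | rfl
    · exact gok_emit _ _
    · exact gok_numS _ _
    · exact gok_emit _ _

/-- The record of a `CNOT`. [cite: AroraBarakCC2009, §6.1] -/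
def cnS (i j : SimExpr) : SimStmt :=
  seqs [GStmt.emit (lits [false, false] ++ unaryTok 3 true ++ sep2 ++ lits (List.replicate 8 true) ++ sep2),
    numS i true, GStmt.emit sep2, numS j true, GStmt.emit (sep2 ++ lits [false, true])]

/-- `cnS` generates the record of a `CNOT`. [folklore] -/
@[simp] theorem out_cnS (i j : SimExpr) (env : SVar → ℕ) :
    (cnS i j).out env = cnotTok (i.eval env) (j.eval env) := by
  simp [cnS, cnotTok, GStmt.out, List.append_assoc]

/-- `cnS` uses the index `Z` only. [folklore] -/
theorem gok_cnS (i j : SimExpr) : GOK [SVar.Z] (cnS i j) :=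
  gok_seqs fun x hx => by
    simp only [List.mem_cons, List.not_mem_nil, or_false] at hx
    rcases hx with rfl | rfl | rfl | rfl | rfl
    · exact gok_emit _ _
    · exact gok_numS _ _
    · exact gok_emit _ _
    · exact gok_numS _ _
    · exact gok_emit _ _

/-- The records of the doubly-controlled-`Z` word. [cite: NielsenChuang2010, §4.3 Fig. 4.9] -/
def cczS (a b c : SimExpr) : SimStmt :=
  seqs [g1S 2 a, g1S 2 b, g1S 2 c,
    cnS a b, g1S 1 b, g1S 1 b, g1S 1 b, g1S 2 b,
    cnS b c, g1S 2 c,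
    cnS a c, g1S 1 c, g1S 1 c, g1S 1 c, g1S 2 c,
    cnS b c, g1S 1 c, g1S 1 c, g1S 1 c, g1S 2 c,
    cnS a c, cnS a b]

/-- `cczS` generates the records of the doubly-controlled-`Z` word. [folklore] -/
@[simp] theorem out_cczS (a b c : SimExpr) (env : SVar → ℕ) :
    (cczS a b c).out env = cczTokN (a.eval env) (b.eval env) (c.eval env) := by
  simp [cczS, cczTokN, List.append_assoc]

/-- `cczS` uses the index `Z` only. [folklore] -/
theorem gok_cczS (a b c : SimExpr) : GOK [SVar.Z] (cczS a b c) :=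
  gok_seqs fun x hx => by
    simp only [List.mem_cons, List.not_mem_nil, or_false] at hx
    rcases hx with rfl | rfl | rfl | rfl | rfl | rfl | rfl | rfl | rfl | rfl | rfl | rfl | rfl | rfl |
      rfl | rfl | rfl | rfl | rfl | rfl | rfl | rfl <;>
    first | exact gok_g1S _ _ | exact gok_cnS _ _

/-- **The records of one reversible operation** with symbolic wires. [cite: NielsenChuang2010, §4.3 Fig. 4.9] -/
def opS : ClOp SimExpr → SimStmt
  | ClOp.not w => seqs [g1S 0 w, g1S 1 w, g1S 1 w, g1S 0 w]
  | ClOp.cnot i j => cnS i j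
  | ClOp.toffoli a b c => seqs [g1S 0 c, cczS a b c, g1S 0 c]

/-- `opS` generates `opTokN` of the evaluated operation. [folklore] -/
@[simp] theorem out_opS (op : ClOp SimExpr) (env : SVar → ℕ) :
    (opS op).out env = opTokN (op.map fun e => e.eval env) := by
  cases op <;> simp [opS, opTokN, ClOp.map, List.append_assoc]

/-- `opS` uses the index `Z` only. [folklore] -/
theorem gok_opS (op : ClOp SimExpr) : GOK [SVar.Z] (opS op) := by
  cases op with
  | not w =>
    exact gok_seqs fun x hx => by
      simp only [List.mem_cons, List.not_mem_nil, or_false] at hx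
      rcases hx with rfl | rfl | rfl | rfl <;> exact gok_g1S _ _
  | cnot i j => exact gok_cnS _ _
  | toffoli a b c =>
    exact gok_seqs fun x hx => by
      simp only [List.mem_cons, List.not_mem_nil, or_false] at hx
      rcases hx with rfl | rfl | rfl
      · exact gok_g1S _ _
      · exact gok_cczS _ _ _
      · exact gok_g1S _ _

/-- The symbolic Toffoli chain (mirror of `clChain`). [cite: NielsenChuang2010, §3.2.5] -/
def clChainS (a₀ : SimExpr) : List SimExpr → List SimExpr → List SimStmt
  | l :: ls, a :: as => opS (ClOp.toffoli a₀ l a) :: clChainS a ls as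
  | _, _ => []

/-- The symbolic chain generates the tokens of `clChain` whenever the wires correspond.
[folklore] -/
theorem out_clChainS {X : Type} (numX : X → ℕ) (env : SVar → ℕ) :
    ∀ (a₀E : SimExpr) (lE aE : List SimExpr) (a₀ : X) (l a : List X),
      a₀E.eval env = numX a₀ → lE.map (fun e => e.eval env) = l.map numX →
      aE.map (fun e => e.eval env) = a.map numX →
      (seqs (clChainS a₀E lE aE)).out env =
        (clChain a₀ l a).flatMap fun op => opTokN (op.map numX)
  | a₀E, [], aE, a₀, l, a, h₀, hl, ha => by
    cases l with
    | nil => simp [clChainS, seqs, GStmt.out]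
    | cons _ _ => simp at hl
  | a₀E, lE, [], a₀, l, a, h₀, hl, ha => by
    cases a with
    | nil => cases lE <;> simp [clChainS, seqs, GStmt.out]
    | cons _ _ => simp at ha
  | a₀E, le :: lE, ae :: aE, a₀, l, a, h₀, hl, ha => by
    cases l with
    | nil => simp at hl
    | cons x l =>
      cases a with
      | nil => simp at ha
      | cons y a =>
        simp only [List.map_cons, List.cons.injEq] at hl ha
        rw [clChainS, clChain, seqs, GStmt.out, List.flatMap_cons,
          out_clChainS numX env ae lE aE y l a ha.1 hl.2 ha.2, out_opS]
        simp [ClOp.map, h₀, hl.1, ha.1]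

/-- The statements of the symbolic chain use the index `Z` only. [folklore] -/
theorem gok_clChainS : ∀ (a₀E : SimExpr) (lE aE : List SimExpr), ∀ s ∈ clChainS a₀E lE aE, GOK [SVar.Z] s
  | a₀E, [], aE => by cases aE <;> simp [clChainS]
  | a₀E, le :: lE, [] => by simp [clChainS]
  | a₀E, le :: lE, ae :: aE => by
    intro s hs
    simp only [clChainS, List.mem_cons] at hs
    rcases hs with rfl | hs
    · exact gok_opS _
    · exact gok_clChainS ae lE aE s hs

/-! ### Polynomial expressions -/

/-- Powers. [folklore] -/
def powE (e : SimExpr) : ℕ → SimExpr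
  | 0 => GExpr.const 1
  | i + 1 => GExpr.mul e (powE e i)

/-- `powE e i` evaluates to the `i`-th power. [folklore] -/
@[simp] theorem eval_powE (e : SimExpr) (env : SVar → ℕ) : ∀ i, (powE e i).eval env = e.eval env ^ i
  | 0 => by simp [powE, GExpr.eval]
  | i + 1 => by rw [powE, GExpr.eval, eval_powE e env i, pow_succ, Nat.mul_comm]

/-- The value of an `ℕ`-polynomial at an expression. [folklore] -/
noncomputable def polyE (p : Polynomial ℕ) (e : SimExpr) : SimExpr :=
  (List.range (p.natDegree + 1)).foldr
    (fun i acc => GExpr.add (GExpr.mul (GExpr.const (p.coeff i)) (powE e i)) acc) (GExpr.const 0)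

/-- `polyE p e` evaluates to `p` at the value of `e`. [folklore] -/
@[simp] theorem eval_polyE (p : Polynomial ℕ) (e : SimExpr) (env : SVar → ℕ) :
    (polyE p e).eval env = p.eval (e.eval env) := by
  rw [Polynomial.eval_eq_sum_range, polyE]
  have : ∀ N : ℕ, ((List.range N).foldr
      (fun i acc => GExpr.add (GExpr.mul (GExpr.const (p.coeff i)) (powE e i)) acc)
      (GExpr.const 0)).eval env = ∑ i ∈ Finset.range N, p.coeff i * e.eval env ^ i := by
    intro N
    induction N with
    | zero => simp [GExpr.eval]
    | succ N ih =>
      rw [List.range_succ, List.foldr_append, Finset.sum_range_succ]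
      have : ∀ (L : List ℕ) (acc : SimExpr), ((L.foldr
          (fun i acc => GExpr.add (GExpr.mul (GExpr.const (p.coeff i)) (powE e i)) acc) acc).eval env)
          = (L.foldr (fun i acc => GExpr.add (GExpr.mul (GExpr.const (p.coeff i)) (powE e i)) acc)
              (GExpr.const 0)).eval env + acc.eval env := by
        intro L acc
        induction L with
        | nil => simp [GExpr.eval]
        | cons x L ihL => simp [GExpr.eval, ihL, Nat.add_assoc]
      rw [this, ih]
      simp [GExpr.eval]
  exact this _

/-! ### The parameters of the family as expressions -/

section Params

variable (M : Turing.TM2ComputableAux Bool Bool) (c k : ℕ) (p : Polynomial ℕ)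

/-- The time bound `N ↦ c N^k + c`. [folklore] -/
abbrev tbF (c k : ℕ) : ℕ → ℕ := fun N => c * N ^ k + c
/-- The coin count `n ↦ p(n)`. [folklore] -/
abbrev pcF (p : Polynomial ℕ) : ℕ → ℕ := fun n => p.eval n

/-- The input length `n`. [folklore] -/
def nE : SimExpr := GExpr.var SVar.N0
/-- The coin count `P = p(n)`. [folklore] -/
noncomputable def PE : SimExpr := polyE p nE
/-- The classical input length `Nw = 2 n + 2 + P`. [folklore] -/
noncomputable def NwE : SimExpr := add (add (mul (const 2) nE) (const 2)) (PE p)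
/-- The number of steps `T = c Nw^k + c + Nw`. [folklore] -/
noncomputable def TE : SimExpr := add (add (mul (const c) (powE (NwE p) k)) (const c)) (NwE p)
/-- The number of cells `S = d T + 3 d + 1 + T`. [folklore] -/
noncomputable def SdE : SimExpr :=
  add (add (add (mul (const (W M).d) (TE c k p)) (const (3 * (W M).d))) (const 1)) (TE c k p)
/-- The block size `nL + (nV + κ (S A))`. [folklore] -/
noncomputable def bsE : SimExpr :=
  add (const (W M).nL) (add (const (W M).nV) (mul (const (W M).κ) (mul (SdE M c k p) (const (W M).A))))
/-- The first tableau wire `n + (P + 2)`. [folklore] -/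
noncomputable def w0E : SimExpr := add nE (add (PE p) (const 2))
/-- The ancilla count `P + (2 + tsize)`. [folklore] -/
noncomputable def mE : SimExpr :=
  add (PE p) (add (const 2) (add (mul (add (TE c k p) (const 1)) (bsE M c k p))
    (mul (TE c k p) (const ((W M).nPat * ((W M).r + 1))))))

variable {M c k p} {n : ℕ} {env : SVar → ℕ}

/-- `nE` evaluates to the input length. [folklore] -/
theorem eval_nE (hN : env SVar.N0 = n) : nE.eval env = n := by simpa [nE, GExpr.eval] using hN

/-- `PE` evaluates to the coin count `p(n)`. [folklore] -/
theorem eval_PE (hN : env SVar.N0 = n) : (PE p).eval env = p.eval n := by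
  simp [PE, eval_nE hN]

/-- `NwE` evaluates to the classical input length `Nw`. [folklore] -/
theorem eval_NwE (hN : env SVar.N0 = n) : (NwE p).eval env = Nw n (p.eval n) := by
  simp [NwE, GExpr.eval, eval_nE hN, eval_PE hN, Nw]

/-- `TE` evaluates to the number of steps `simT`. [folklore] -/
theorem eval_TE (hN : env SVar.N0 = n) : (TE c k p).eval env = simT (tbF c k) (pcF p) n := by
  simp [TE, GExpr.eval, eval_NwE hN, simT]

/-- `SdE` evaluates to the number of cells `sS`. [folklore] -/
theorem eval_SdE (hN : env SVar.N0 = n) :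
    (SdE M c k p).eval env = sS M (simT (tbF c k) (pcF p) n) := by
  simp only [SdE, GExpr.eval, eval_TE hN, sS]

/-- `bsE` evaluates to the block size `bsize`. [folklore] -/
theorem eval_bsE (hN : env SVar.N0 = n) :
    (bsE M c k p).eval env = (W M).bsize (sS M (simT (tbF c k) (pcF p) n)) := by
  simp only [bsE, GExpr.eval, eval_SdE hN, WM.bsize]

/-- `w0E` evaluates to the first tableau wire `w0`. [folklore] -/
theorem eval_w0E (hN : env SVar.N0 = n) : (w0E p).eval env = w0 n (p.eval n) := by
  simp only [w0E, GExpr.eval, eval_nE hN, eval_PE hN, w0]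

/-- `mE` evaluates to the ancilla count `p(n) + simM n`. [folklore] -/
theorem eval_mE (hN : env SVar.N0 = n) :
    (mE M c k p).eval env = pcF p n + simM M (tbF c k) (pcF p) n := by
  simp only [mE, GExpr.eval, eval_PE hN, eval_TE hN, eval_bsE hN, simM, mM, WM.tsize]

/-! ### Symbolic wires -/

variable (M c k p)

/-- Label wire `l` of block `t`. [folklore] -/
noncomputable def labE (t : SimExpr) (l : Fin (W M).nL) : SimExpr :=
  add (w0E p) (add (const l) (mul (bsE M c k p) t))
/-- State wire `v` of block `t`. [folklore] -/
noncomputable def varE (t : SimExpr) (v : Fin (W M).nV) : SimExpr :=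
  add (w0E p) (add (add (const (W M).nL) (const v)) (mul (bsE M c k p) t))
/-- Cell wire `(kk, j, g)` of block `t`. [folklore] -/
noncomputable def cellE (t : SimExpr) (kk : Fin (W M).κ) (j : SimExpr) (g : Fin (W M).A) : SimExpr :=
  add (w0E p) (add (add (const (W M).nL) (add (const (W M).nV)
    (add (add (const g) (mul (const (W M).A) j)) (mul (mul (SdE M c k p) (const (W M).A)) (const kk)))))
      (mul (bsE M c k p) t))
/-- Ancilla wire `(t, ξ, q)`. [folklore] -/
noncomputable def ancE (t : SimExpr) (ξ : (W M).Pat) (q : ℕ) : SimExpr :=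
  add (w0E p) (add (mul (add (TE c k p) (const 1)) (bsE M c k p))
    (add (add (const q) (const (((W M).r + 1) * ((W M).ePat ξ : ℕ)))) (mul (const ((W M).nPat * ((W M).r + 1))) t)))

variable {M c k p}

local notation "Pv" => Polynomial.eval n p
local notation "Tv" => simT (tbF c k) (pcF p) n
local notation "Sv" => sS M (simT (tbF c k) (pcF p) n)

/-- `labE` evaluates to the number of a label wire (`num_tw_lab`). [folklore] -/
theorem eval_labE (hN : env SVar.N0 = n) (t : SimExpr) (l : Fin (W M).nL) :
    (labE M c k p t l).eval env = w0 n Pv + ((l : ℕ) + (W M).bsize Sv * t.eval env) := by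
  simp only [labE, GExpr.eval, eval_w0E hN, eval_bsE hN]

/-- `varE` evaluates to the number of a state wire (`num_tw_var`). [folklore] -/
theorem eval_varE (hN : env SVar.N0 = n) (t : SimExpr) (v : Fin (W M).nV) :
    (varE M c k p t v).eval env = w0 n Pv + ((W M).nL + (v : ℕ) + (W M).bsize Sv * t.eval env) := by
  simp only [varE, GExpr.eval, eval_w0E hN, eval_bsE hN]

/-- `cellE` evaluates to the number of a cell wire (`num_tw_cell`). [folklore] -/
theorem eval_cellE (hN : env SVar.N0 = n) (t : SimExpr) (kk : Fin (W M).κ) (j : SimExpr) (g : Fin (W M).A) :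
    (cellE M c k p t kk j g).eval env = w0 n Pv + ((W M).nL + ((W M).nV +
      ((g : ℕ) + (W M).A * j.eval env + Sv * (W M).A * kk)) + (W M).bsize Sv * t.eval env) := by
  simp only [cellE, GExpr.eval, eval_w0E hN, eval_bsE hN, eval_SdE hN]

/-- `ancE` evaluates to the number of an ancilla wire (`num_tw_anc`). [folklore] -/
theorem eval_ancE (hN : env SVar.N0 = n) (t : SimExpr) (ξ : (W M).Pat) (q : ℕ) :
    (ancE M c k p t ξ q).eval env = w0 n Pv + ((Tv + 1) * (W M).bsize Sv +
      (q + ((W M).r + 1) * ((W M).ePat ξ : ℕ) + (W M).nPat * ((W M).r + 1) * t.eval env)) := by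
  simp only [ancE, GExpr.eval, eval_w0E hN, eval_bsE hN, eval_TE hN]

end Params

/-! ### The pieces of the generator -/

section Family

variable (M : Turing.TM2ComputableAux Bool Bool) (c k : ℕ) (p : Polynomial ℕ)

variable {M c k p} in
/-- `opFor` on a new top cell is a `CNOT`. [folklore] -/
theorem opFor_cellB_lt (Mw : WM) {S T : ℕ} (t : Fin T) (ξ : Mw.Pat) (kk : Fin Mw.κ) (j : Fin S)
    (g : Fin Mw.A) (h : (j : ℕ) < (Mw.newTop ξ kk).length) :
    WM.opFor t ξ (Mw.cellB kk j g) = ClOp.cnot (WM.mw t ξ) (Sum.inl (t.succ, Mw.cellB kk j g)) := by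
  simp [WM.opFor, WM.cellB, h]

variable {M c k p} in
/-- `opFor` on a shifted cell is a Toffoli copying the source cell. [folklore] -/
theorem opFor_cellB_ge (Mw : WM) {S T : ℕ} (t : Fin T) (ξ : Mw.Pat) (kk : Fin Mw.κ) (j : Fin S)
    (g : Fin Mw.A) (h : ¬ (j : ℕ) < (Mw.newTop ξ kk).length) :
    WM.opFor t ξ (Mw.cellB kk j g) = ClOp.toffoli (WM.mw t ξ)
      (Sum.inl (t.castSucc, Mw.cellB kk (WM.srcIdx ξ kk j) g)) (Sum.inl (t.succ, Mw.cellB kk j g)) := by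
  simp [WM.opFor, WM.cellB, h]

variable {M c k p} in
/-- Updating a loop index keeps the input variable. [folklore] -/
theorem hN_update {n : ℕ} {env : SVar → ℕ} (hN : env SVar.N0 = n) (x : SVar) (hx : x ≠ SVar.N0)
    (v : ℕ) : Function.update env x v SVar.N0 = n := by
  rw [Function.update_of_ne (Ne.symm hx)]; exact hN

/-- Numbers of tableau wires. [folklore] -/
abbrev numtw (n : ℕ) (x : TW M (simT (tbF c k) (pcF p) n)) : ℕ := num M (tw x : Idx M n (pcF p n) (simT (tbF c k) (pcF p) n))

/-! #### Header, coins, final swap -/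

/-- The Hadamard records on the coin wires `n + j`, `j < P`. [cite: BernsteinVazirani1997, Thm. 8.3 (proof)] -/
noncomputable def hadS : SimStmt := loop SVar.J (PE p) (g1S 0 (add nE (var SVar.J)))

/-- **The coin piece generates the tokens of the Hadamard layer.** [cite: BernsteinVazirani1997, Thm. 8.3 (proof)] -/
theorem out_hadS {n : ℕ} {env : SVar → ℕ} (hN : env SVar.N0 = n) (m : ℕ) :
    (hadS p).out env = (hadamardLayer n (pcF p n) m).flatMap gateTok := by
  rw [flatMap_gateTok_hadamardLayer]
  simp only [hadS, GStmt.out, eval_PE hN, out_g1S, GExpr.eval, Function.update_self]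
  refine List.flatMap_congr fun j _ => ?_
  rw [eval_nE (hN_update hN SVar.J (by decide) j)]

/-- `hadS` uses the indices `Z, J`. [folklore] -/
theorem gok_hadS : GOK [SVar.Z, SVar.J] (hadS p) :=
  gok_loop (gok_g1S _ _) (by decide) (by decide) (by decide)

/-- The header: `n` (doubled binary), separator, `2 m` ones, separator. [cite: AroraBarakCC2009, §6.1] -/
noncomputable def headerS : SimStmt :=
  seqs [numS nE false, GStmt.emit (lits [false, true]),
    loop SVar.J (mE M c k p) (GStmt.emit [Tok.lit true, Tok.lit true]), GStmt.emit (lits [false, true])]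

/-- **The header piece generates the header of `descTok`.** [cite: AroraBarakCC2009, §6.1] -/
theorem out_headerS {n : ℕ} {env : SVar → ℕ} (hN : env SVar.N0 = n) :
    (headerS M c k p).out env = unaryTok n false ++ lits [false, true] ++
      lits (List.replicate (2 * (pcF p n + simM M (tbF c k) (pcF p) n)) true) ++ lits [false, true] := by
  simp only [headerS, out_seqs, List.flatMap_cons, List.flatMap_nil, List.append_nil, out_numS,
    eval_nE hN, GStmt.out, eval_mE hN, List.append_assoc]
  congr 2
  simp only [range_flatMap_const, lits, List.map_replicate, List.map_cons, List.map_nil]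
  rw [show (2 : ℕ) * _ = _ * 2 from Nat.mul_comm _ _, ← List.flatten_replicate_replicate]
  rfl

/-- `headerS` uses the indices `Z, J`. [folklore] -/
theorem gok_headerS : GOK [SVar.Z, SVar.J] (headerS M c k p) :=
  gok_seqs fun x hx => by
    simp only [List.mem_cons, List.not_mem_nil, or_false] at hx
    rcases hx with rfl | rfl | rfl | rfl
    · exact gok_mono (gok_numS _ _) (by decide)
    · exact gok_emit _ _
    · exact gok_loop (B := []) (gok_emit _ _) (by simp) (by simp) (by decide)
    · exact gok_emit _ _

/-- The answer wire. [folklore] -/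
noncomputable def ansE : SimExpr := cellE M c k p (TE c k p) (k₁' M) (const 0) (cOut M)

/-- The final swap of wire `0` with the answer wire. [cite: NielsenChuang2010, §1.3.4] -/
noncomputable def swapS : SimStmt :=
  seqs [cnS (ansE M c k p) (const 0), cnS (const 0) (ansE M c k p), cnS (ansE M c k p) (const 0)]

/-- **The swap piece generates the tokens of `swapOps`.** [cite: NielsenChuang2010, §1.3.4] -/
theorem out_swapS {n : ℕ} {env : SVar → ℕ} (hN : env SVar.N0 = n) :
    (swapS M c k p).out env = (swapOps M n (pcF p n) (simT (tbF c k) (pcF p) n)).flatMap fun op => opTokN (op.map (num M)) := by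
  have ha : (ansE M c k p).eval env = num M (tw (ansT M (simT (tbF c k) (pcF p) n)) : Idx M n (pcF p n) (simT (tbF c k) (pcF p) n)) := by
    rw [ansE, eval_cellE hN, num_ansT, eval_TE hN]
    simp [GExpr.eval]
  simp [swapS, swapOps, ClOp.map, GExpr.eval, ha, num_zeroW, opTokN]

/-- `swapS` uses the index `Z` only. [folklore] -/
theorem gok_swapS : GOK [SVar.Z] (swapS M c k p) :=
  gok_seqs fun x hx => by
    simp only [List.mem_cons, List.not_mem_nil, or_false] at hx
    rcases hx with rfl | rfl | rfl <;> exact gok_cnS _ _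

/-! #### The tableau -/

/-- Symbolic literals of pattern `ξ` in block `TT` (mirror of `WM.lits`). [folklore] -/
noncomputable def litsE (ξ : (W M).Pat) : List SimExpr :=
  labE M c k p (var SVar.TT) ξ.1 :: varE M c k p (var SVar.TT) ξ.2.1 ::
    (List.finRange (W M).κ).flatMap fun (kk : Fin (W M).κ) =>
      (List.finRange (W M).d).map fun (i : Fin (W M).d) =>
        cellE M c k p (var SVar.TT) kk (const i) (ξ.2.2 kk i)

/-- Symbolic chain ancillas (mirror of `WM.ancs`). [folklore] -/
noncomputable def ancsE (ξ : (W M).Pat) : List SimExpr :=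
  (List.finRange (W M).r).map fun (q : Fin (W M).r) => ancE M c k p (var SVar.TT) ξ (q + 1)

/-- Symbolic minterm wire (mirror of `WM.mw`). [folklore] -/
noncomputable def mwE (ξ : (W M).Pat) : SimExpr := ancE M c k p (var SVar.TT) ξ (W M).r

/-- Symbolic minterm chain (mirror of `WM.chainOps`). [cite: Sipser2012, Thm. 9.30 (proof)] -/
noncomputable def chainS (ξ : (W M).Pat) : SimStmt :=
  GStmt.seq (opS (ClOp.not (ancE M c k p (var SVar.TT) ξ 0)))
    (seqs (clChainS (ancE M c k p (var SVar.TT) ξ 0) (litsE M c k p ξ) (ancsE M c k p ξ)))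

/-- The number of shifted cells `S - d - len = d T + T + (2 d + 1 - len)`. [folklore] -/
noncomputable def SdlE (len : ℕ) : SimExpr :=
  add (add (mul (const (W M).d) (TE c k p)) (TE c k p)) (const (2 * (W M).d + 1 - len))

/-- Symbolic output operations of pattern `ξ` (mirror of `WM.outOps`): the new label and
state, the new top cells, and the loop over the shifted cells. [cite: Sipser2012, Thm. 9.30 (proof)] -/
noncomputable def outS (ξ : (W M).Pat) : SimStmt :=
  GStmt.seq (opS (ClOp.cnot (mwE M c k p ξ) (labE M c k p (add (var SVar.TT) (const 1)) ((W M).out ξ).1))) <|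
  GStmt.seq (opS (ClOp.cnot (mwE M c k p ξ) (varE M c k p (add (var SVar.TT) (const 1)) ((W M).out ξ).2.1))) <|
  seqs ((List.finRange (W M).κ).map fun (kk : Fin (W M).κ) =>
    GStmt.seq
      (seqs ((List.finRange ((W M).newTop ξ kk).length).map fun (j : Fin ((W M).newTop ξ kk).length) =>
        opS (ClOp.cnot (mwE M c k p ξ)
          (cellE M c k p (add (var SVar.TT) (const 1)) kk (const j) (((W M).newTop ξ kk)[j])))))
      (loop SVar.I (SdlE M c k p ((W M).newTop ξ kk).length)
        (seqs ((List.finRange (W M).A).map fun (g : Fin (W M).A) =>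
          opS (ClOp.toffoli (mwE M c k p ξ)
            (cellE M c k p (var SVar.TT) kk (add (var SVar.I) (const (W M).d)) g)
            (cellE M c k p (add (var SVar.TT) (const 1)) kk
              (add (const ((W M).newTop ξ kk).length) (var SVar.I)) g))))))

/-- One step of the tableau: all patterns. [cite: Sipser2012, Thm. 9.30 (proof)] -/
noncomputable def stepS : SimStmt :=
  seqs ((W M).patList.map fun ξ => GStmt.seq (chainS M c k p ξ) (outS M c k p ξ))

/-- The tableau: steps `0, …, T - 1`. [cite: AroraBarakCC2009, Thm. 6.6 (proof)] -/
noncomputable def tabS : SimStmt := loop SVar.TT (TE c k p) (stepS M c k p)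

variable {M c k p}

/-- The symbolic literals evaluate to the numbers of `WM.lits`. [folklore] -/
theorem map_eval_litsE {n : ℕ} {env : SVar → ℕ} (hN : env SVar.N0 = n) {t : Fin (simT (tbF c k) (pcF p) n)}
    (hT : env SVar.TT = t) (ξ : (W M).Pat) :
    (litsE M c k p ξ).map (fun e => e.eval env) =
      (WM.lits (sS_hS M (simT (tbF c k) (pcF p) n)) t.castSucc ξ).map (numtw M c k p n) := by
  rw [litsE, WM.lits, List.map_cons, List.map_cons, List.map_cons, List.map_cons]
  simp only [numtw]
  rw [num_tw_lab, num_tw_var]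
  simp only [List.map_flatMap, List.map_map, Function.comp_def, eval_labE hN, eval_varE hN,
    eval_cellE hN, GExpr.eval, hT, num_tw_cell, Fin.val_castSucc]

/-- The symbolic chain ancillas evaluate to the numbers of `WM.ancs`. [folklore] -/
theorem map_eval_ancsE {n : ℕ} {env : SVar → ℕ} (hN : env SVar.N0 = n) {t : Fin (simT (tbF c k) (pcF p) n)}
    (hT : env SVar.TT = t) (ξ : (W M).Pat) :
    (ancsE M c k p ξ).map (fun e => e.eval env) = (WM.ancs (S := (sS M (simT (tbF c k) (pcF p) n))) t ξ).map (numtw M c k p n) := by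
  simp only [ancsE, WM.ancs, WM.anc, List.map_map, Function.comp_def, numtw, eval_ancE hN,
    GExpr.eval, hT, num_tw_anc, Fin.val_succ]

/-- The first symbolic ancilla evaluates to the number of `WM.anc t ξ 0`. [folklore] -/
theorem eval_anc0 {n : ℕ} {env : SVar → ℕ} (hN : env SVar.N0 = n) {t : Fin (simT (tbF c k) (pcF p) n)}
    (hT : env SVar.TT = t) (ξ : (W M).Pat) :
    (ancE M c k p (var SVar.TT) ξ 0).eval env = numtw M c k p n (WM.anc t ξ 0) := by
  simp only [WM.anc, numtw, eval_ancE hN, GExpr.eval, hT, num_tw_anc, Fin.val_zero]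

/-- The symbolic minterm wire evaluates to the number of `WM.mw`. [folklore] -/
theorem eval_mwE {n : ℕ} {env : SVar → ℕ} (hN : env SVar.N0 = n) {t : Fin (simT (tbF c k) (pcF p) n)}
    (hT : env SVar.TT = t) (ξ : (W M).Pat) :
    (mwE M c k p ξ).eval env = numtw M c k p n (WM.mw t ξ) := by
  simp only [mwE, WM.mw, WM.anc, numtw, eval_ancE hN, GExpr.eval, hT, num_tw_anc, Fin.val_last]

/-- **The chain piece generates the chain tokens.** [folklore] -/
theorem out_chainS {n : ℕ} {env : SVar → ℕ} (hN : env SVar.N0 = n) {t : Fin (simT (tbF c k) (pcF p) n)}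
    (hT : env SVar.TT = t) (ξ : (W M).Pat) :
    (chainS M c k p ξ).out env =
      (WM.chainOps (sS_hS M (simT (tbF c k) (pcF p) n)) t ξ).flatMap fun op => opTokN (op.map (numtw M c k p n)) := by
  rw [chainS, GStmt.out, WM.chainOps, List.flatMap_cons, out_opS,
    out_clChainS (numtw M c k p n) env _ _ _ (WM.anc t ξ 0) _ _ (eval_anc0 hN hT ξ)
      (map_eval_litsE hN hT ξ) (map_eval_ancsE hN hT ξ)]
  simp only [ClOp.map, eval_anc0 hN hT ξ]

/-- `SdlE len` evaluates to the number of shifted cells `S - d - len`. [folklore] -/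
theorem eval_SdlE {n : ℕ} {env : SVar → ℕ} (hN : env SVar.N0 = n) {len : ℕ} (hlen : len ≤ 2 * (W M).d) :
    (SdlE M c k p len).eval env = (sS M (simT (tbF c k) (pcF p) n)) - (W M).d - len := by
  have h1 : (SdlE M c k p len).eval env =
      (W M).d * simT (tbF c k) (pcF p) n + simT (tbF c k) (pcF p) n + (2 * (W M).d + 1 - len) := by
    simp only [SdlE, GExpr.eval, eval_TE hN]
  have h2 : sS M (simT (tbF c k) (pcF p) n) =
      (W M).d * simT (tbF c k) (pcF p) n + 3 * (W M).d + 1 + simT (tbF c k) (pcF p) n := rfl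
  rw [h1, h2]
  generalize (W M).d * simT (tbF c k) (pcF p) n = a
  omega

/-- **The output piece generates the output tokens.** [folklore] -/
theorem out_outS {n : ℕ} {env : SVar → ℕ} (hN : env SVar.N0 = n) {t : Fin (simT (tbF c k) (pcF p) n)}
    (hT : env SVar.TT = t) (ξ : (W M).Pat) :
    (outS M c k p ξ).out env =
      (WM.outOps (sS_hS M (simT (tbF c k) (pcF p) n)) t ξ).flatMap fun op => opTokN (op.map (numtw M c k p n)) := by
  have hmw := eval_mwE hN hT ξ
  rw [WM.outOps, List.flatMap_map, WM.tgtList, List.flatMap_cons, List.flatMap_cons, outS, GStmt.out,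
    GStmt.out, out_opS, out_opS, out_seqs, List.flatMap_map, List.flatMap_assoc]
  congr 1
  · simp only [ClOp.map, hmw, WM.opFor, numtw]
    rw [num_tw_lab]
    simp only [eval_labE hN, GExpr.eval, hT, Fin.val_succ]
  congr 1
  · simp only [ClOp.map, hmw, WM.opFor, numtw]
    rw [num_tw_var]
    simp only [eval_varE hN, GExpr.eval, hT, Fin.val_succ]
  refine List.flatMap_congr fun kk _ => ?_
  rw [GStmt.out, out_seqs, List.flatMap_map, List.flatMap_append]
  congr 1
  · rw [List.flatMap_map]
    refine List.flatMap_congr fun j _ => ?_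
    have hj : ((⟨(j : ℕ), by have := j.2; have := (W M).length_newTop_le ξ kk; have := sS_hS M (simT (tbF c k) (pcF p) n); omega⟩ :
        Fin (sS M (simT (tbF c k) (pcF p) n))) : ℕ) < ((W M).newTop ξ kk).length := j.2
    rw [opFor_cellB_lt _ _ _ _ _ _ hj]
    simp only [out_opS, ClOp.map, hmw, numtw, eval_cellE hN, GExpr.eval, hT, num_tw_cell, Fin.val_succ]
  · rw [GStmt.out, eval_SdlE hN ((W M).length_newTop_le ξ kk), ← finRange_flatMap_val,
      List.flatMap_assoc]
    refine List.flatMap_congr fun i _ => ?_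
    rw [out_seqs, List.flatMap_map, List.flatMap_map]
    refine List.flatMap_congr fun g _ => ?_
    have hi := i.2
    have hnj : ¬ ((⟨((W M).newTop ξ kk).length + (i : ℕ), by omega⟩ : Fin (sS M (simT (tbF c k) (pcF p) n))) : ℕ) <
        ((W M).newTop ξ kk).length := by simp
    have hsrc : ((WM.srcIdx ξ kk (⟨((W M).newTop ξ kk).length + (i : ℕ), by omega⟩ :
        Fin (sS M (simT (tbF c k) (pcF p) n))) : Fin (sS M (simT (tbF c k) (pcF p) n))) : ℕ)
        = (i : ℕ) + (W M).d := by
      have hd : (W M).d = TM2Sim.depth M.tm := rfl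
      simp only [WM.srcIdx, Fin.val_mk]
      omega
    have hN' := hN_update hN SVar.I (by decide) (i : ℕ)
    rw [opFor_cellB_ge _ _ _ _ _ _ hnj]
    simp only [out_opS, ClOp.map, numtw, eval_cellE hN',
      eval_mwE hN' (t := t) (by rw [Function.update_of_ne (by decide)]; exact hT), GExpr.eval,
      Function.update_self, Function.update_of_ne (show SVar.TT ≠ SVar.I by decide), hT,
      num_tw_cell, Fin.val_succ, Fin.val_castSucc, hsrc]

/-- **One step generates the step tokens.** [folklore] -/
theorem out_stepS {n : ℕ} {env : SVar → ℕ} (hN : env SVar.N0 = n) {t : Fin (simT (tbF c k) (pcF p) n)}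
    (hT : env SVar.TT = t) :
    (stepS M c k p).out env =
      (WM.stepOps (sS_hS M (simT (tbF c k) (pcF p) n)) t).flatMap fun op => opTokN (op.map (numtw M c k p n)) := by
  rw [stepS, out_seqs, List.flatMap_map, WM.stepOps, List.flatMap_assoc]
  refine List.flatMap_congr fun ξ _ => ?_
  rw [GStmt.out, List.flatMap_append, out_chainS hN hT, out_outS hN hT]

/-- **The tableau piece generates the tableau tokens.** [cite: AroraBarakCC2009, Thm. 6.6 (proof)] -/
theorem out_tabS {n : ℕ} {env : SVar → ℕ} (hN : env SVar.N0 = n) :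
    (tabS M c k p).out env = (tabOps M n (pcF p n) (simT (tbF c k) (pcF p) n)).flatMap fun op => opTokN (op.map (num M)) := by
  rw [tabS, GStmt.out, eval_TE hN, tabOps, List.flatMap_map, WM.tableauOps, List.flatMap_assoc]
  refine range_flatMap_congr fun t ht => ?_
  rw [WM.stepOpsN, dif_pos ht, out_stepS (hN_update hN SVar.TT (by decide) t) (t := ⟨t, ht⟩)
    (Function.update_self _ _ _)]
  refine List.flatMap_congr fun op _ => ?_
  rw [ClOp.map_map]
  rfl

/-! #### Loop-index discipline of the tableau pieces -/

/-- `chainS` uses the index `Z` only. [folklore] -/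
theorem gok_chainS (ξ : (W M).Pat) : GOK [SVar.Z] (chainS M c k p ξ) :=
  gok_seq (gok_opS _) (gok_seqs (gok_clChainS _ _ _))

/-- `outS` uses the indices `Z, I`. [folklore] -/
theorem gok_outS (ξ : (W M).Pat) : GOK [SVar.Z, SVar.I] (outS M c k p ξ) := by
  refine gok_seq (gok_mono (gok_opS _) (by decide)) (gok_seq (gok_mono (gok_opS _) (by decide))
    (gok_seqs fun s hs => ?_))
  obtain ⟨kk, -, rfl⟩ := List.mem_map.1 hs
  refine gok_seq (gok_seqs fun s' hs' => ?_) (gok_loop (B := [SVar.Z]) (gok_seqs fun s' hs' => ?_)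
    (by decide) (by decide) (by decide))
  · obtain ⟨j, -, rfl⟩ := List.mem_map.1 hs'
    exact gok_mono (gok_opS _) (by decide)
  · obtain ⟨g, -, rfl⟩ := List.mem_map.1 hs'
    exact gok_opS _

/-- `stepS` uses the indices `Z, I`. [folklore] -/
theorem gok_stepS : GOK [SVar.Z, SVar.I] (stepS M c k p) :=
  gok_seqs fun s hs => by
    obtain ⟨ξ, -, rfl⟩ := List.mem_map.1 hs
    exact gok_seq (gok_mono (gok_chainS ξ) (by decide)) (gok_outS ξ)

/-- `tabS` uses the indices `Z, I, TT`. [folklore] -/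
theorem gok_tabS : GOK [SVar.Z, SVar.I, SVar.TT] (tabS M c k p) :=
  gok_loop (B := [SVar.Z, SVar.I]) gok_stepS (by decide) (by decide) (by decide)

end Family

/-! #### The initialisation of block `0` -/

section Init

variable (M : Turing.TM2ComputableAux Bool Bool) (c k : ℕ) (p : Polynomial ℕ)

/-- `2 n`. [folklore] -/
def twoNE : SimExpr := mul (const 2) nE

/-- The number of cells beyond the classical input: `S - Nw = d T + 3 d + 1 + (c Nw^k + c)`. [folklore] -/
noncomputable def RE : SimExpr :=
  add (add (add (mul (const (W M).d) (TE c k p)) (const (3 * (W M).d))) (const 1))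
    (add (mul (const c) (powE (NwE p) k)) (const c))

/-- Symbolic cell wire `(kk, j, g)` of block `0`. [folklore] -/
noncomputable def cell0E (kk : Fin (W M).κ) (j : SimExpr) (g : Fin (W M).A) : SimExpr :=
  cellE M c k p (const 0) kk j g

/-- For every code `g` with `P g`: negate the cell wire `(kk, j, g)` of block `0` (mirror of one
cell of `initNots`). [folklore] -/
noncomputable def notsIf (kk : Fin (W M).κ) (j : SimExpr) (P : Fin (W M).A → Bool) : SimStmt :=
  seqs ((List.finRange (W M).A).map fun g =>
    if P g then opS (ClOp.not (cell0E M c k p kk j g)) else GStmt.emit [])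

/-- The negations of block `0` on the input stack, by segments: the doubled bits `j < 2 n`,
the separator cells `2 n` and `2 n + 1`, the coins `2 n + 2 ≤ j < Nw`, the empty cells
`Nw ≤ j < S` (mirror of `notPred` on the input stack). [cite: Sipser2012, Thm. 9.30 (proof)] -/
noncomputable def notsK0S : SimStmt :=
  seqs [loop SVar.J twoNE (notsIf M c k p (k₀' M) (var SVar.J) fun g => decide (g = cB M false)),
    notsIf M c k p (k₀' M) twoNE fun g => decide (g = cB M false),
    notsIf M c k p (k₀' M) (add twoNE (const 1)) fun g => decide (g = cB M true),
    loop SVar.J (PE p)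
      (notsIf M c k p (k₀' M) (add (add twoNE (const 2)) (var SVar.J)) fun g =>
        decide (g = cB M false)),
    loop SVar.J (RE M c k p)
      (notsIf M c k p (k₀' M) (add (NwE p) (var SVar.J)) fun g => decide (g = 0))]

/-- The negations of block `0` on another stack: the empty code in all cells. [folklore] -/
noncomputable def notsOtherS (kk : Fin (W M).κ) : SimStmt :=
  loop SVar.J (SdE M c k p) (notsIf M c k p kk (var SVar.J) fun g => decide (g = 0))

/-- **The negations of the initialisation** (mirror of `initNots`): the initial label and
state, then the stacks. [cite: Sipser2012, Thm. 9.30 (proof)] -/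
noncomputable def initNotsS : SimStmt :=
  seqs [
    seqs ((List.finRange (W M).nL).map fun l =>
      if l = TM2Bridge.eL M.tm (some M.tm.main) then
        opS (ClOp.not (labE M c k p (const 0) l)) else GStmt.emit []),
    seqs ((List.finRange (W M).nV).map fun v =>
      if v = TM2Bridge.eV M.tm M.tm.initialState then
        opS (ClOp.not (varE M c k p (const 0) v)) else GStmt.emit []),
    seqs ((List.finRange (W M).κ).map fun kk =>
      if kk = k₀' M then notsK0S M c k p else notsOtherS M c k p kk)]

/-- For the two bit codes `g`: a `CNOT` from `src` into the cell wire `(k₀, j, g)` of block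
`0` (mirror of one cell of `initCnots`). [folklore] -/
noncomputable def cnotsIf (j src : SimExpr) : SimStmt :=
  seqs ((List.finRange (W M).A).map fun g =>
    if g = cB M true ∨ g = cB M false then
      opS (ClOp.cnot src (cell0E M c k p (k₀' M) j g)) else GStmt.emit [])

/-- The `CNOT`s of block `0` on the input stack: input wire `i` into the cells `2 i` and
`2 i + 1`, coin wire `n + i` into the cell `2 n + 2 + i`. [folklore] -/
noncomputable def cnotsK0S : SimStmt :=
  GStmt.seq
    (loop SVar.I nE (GStmt.seq (cnotsIf M c k p (mul (const 2) (var SVar.I)) (var SVar.I))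
      (cnotsIf M c k p (add (mul (const 2) (var SVar.I)) (const 1)) (var SVar.I))))
    (loop SVar.I (PE p)
      (cnotsIf M c k p (add (add twoNE (const 2)) (var SVar.I)) (add nE (var SVar.I))))

/-- **The `CNOT`s of the initialisation** (mirror of `initCnots`). [folklore] -/
noncomputable def initCnotsS : SimStmt :=
  seqs ((List.finRange (W M).κ).map fun kk =>
    if kk = k₀' M then cnotsK0S M c k p else GStmt.emit [])

variable {M c k p} {n : ℕ} {env : SVar → ℕ}

local notation "Pv" => Polynomial.eval n p
local notation "Tv" => simT (tbF c k) (pcF p) n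
local notation "Sv" => sS M (simT (tbF c k) (pcF p) n)

/-- `twoNE` evaluates to `2 n`. [folklore] -/
theorem eval_twoNE (hN : env SVar.N0 = n) : twoNE.eval env = 2 * n := by
  simp only [twoNE, GExpr.eval, eval_nE hN]

/-- `Nw + (S - Nw) = S`. [folklore] -/
theorem Nw_add_eval_RE (hN : env SVar.N0 = n) : Nw n Pv + (RE M c k p).eval env = Sv := by
  simp only [RE, GExpr.eval, eval_TE hN, eval_powE, eval_NwE hN, sS, simT, tbF, pcF]
  ring

/-- `cell0E` evaluates to the number `cellN` of a cell wire of block `0`. [folklore] -/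
theorem eval_cell0E (hN : env SVar.N0 = n) (kk : Fin (W M).κ) (j : SimExpr) (g : Fin (W M).A) :
    (cell0E M c k p kk j g).eval env = cellN M n Pv Sv kk (j.eval env) g := by
  simp only [cell0E, eval_cellE hN, GExpr.eval, Nat.mul_zero, Nat.add_zero, cellN]

/-- `notsIf` generates the conditional negations of one cell. [folklore] -/
theorem out_notsIf (hN : env SVar.N0 = n) (kk : Fin (W M).κ) (j : SimExpr) (P : Fin (W M).A → Bool) :
    (notsIf M c k p kk j P).out env =
      (List.finRange (W M).A).flatMap fun g =>
        if P g then opTokN (ClOp.not (cellN M n Pv Sv kk (j.eval env) g)) else [] := by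
  rw [notsIf, out_seqs, List.flatMap_map]
  refine List.flatMap_congr fun g _ => ?_
  cases P g <;> simp [GStmt.out, ClOp.map, eval_cell0E hN]

/-- `notsOtherS` generates the negations of block `0` on a non-input stack. [folklore] -/
theorem out_notsOtherS (hN : env SVar.N0 = n) (kk : Fin (W M).κ) (hk : kk ≠ k₀' M) :
    (notsOtherS M c k p kk).out env =
      (List.range Sv).flatMap fun j => (List.finRange (W M).A).flatMap fun g =>
        if notPredN M n Pv (decide (kk = k₀' M)) j g then
          opTokN (ClOp.not (cellN M n Pv Sv kk j g)) else [] := by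
  rw [notsOtherS, GStmt.out, eval_SdE hN]
  refine List.flatMap_congr fun j _ => ?_
  rw [out_notsIf (hN_update hN SVar.J (by decide) j)]
  refine List.flatMap_congr fun g _ => ?_
  simp [notPredN, hk, GExpr.eval]

/-- Splitting the cells of a stack into the five segments of the input stack. [folklore] -/
theorem range_S_flatMap (hN : env SVar.N0 = n) (f : ℕ → List Tok) :
    (List.range Sv).flatMap f =
      (List.range (2 * n)).flatMap f ++ (f (2 * n) ++ (f (2 * n + 1) ++
        ((List.range Pv).flatMap (fun i => f (2 * n + 2 + i)) ++
          (List.range ((RE M c k p).eval env)).flatMap fun i => f (Nw n Pv + i)))) := by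
  rw [← Nw_add_eval_RE hN, range_add_flatMap, Nw, range_add_flatMap,
    show 2 * n + 2 = 2 * n + 1 + 1 from rfl, List.range_succ, List.range_succ]
  simp [List.flatMap_append, List.append_assoc]

/-- `notsK0S` generates the negations of block `0` on the input stack. [cite: Sipser2012, Thm. 9.30 (proof)] -/
theorem out_notsK0S (hN : env SVar.N0 = n) :
    (notsK0S M c k p).out env =
      (List.range Sv).flatMap fun j => (List.finRange (W M).A).flatMap fun g =>
        if notPredN M n Pv true j g then opTokN (ClOp.not (cellN M n Pv Sv (k₀' M) j g)) else [] := by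
  rw [range_S_flatMap hN, notsK0S, out_seqs]
  simp only [List.flatMap_cons, List.flatMap_nil, List.append_nil]
  congr 1
  · rw [GStmt.out, eval_twoNE hN]
    refine range_flatMap_congr fun j hj => ?_
    rw [out_notsIf (hN_update hN SVar.J (by decide) j)]
    refine List.flatMap_congr fun g _ => ?_
    rw [notPredN_lt M hj]
    simp [GExpr.eval]
  congr 1
  · rw [out_notsIf hN]
    refine List.flatMap_congr fun g _ => ?_
    rw [notPredN_2n, eval_twoNE hN]
  congr 1
  · rw [out_notsIf hN]
    refine List.flatMap_congr fun g _ => ?_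
    rw [notPredN_2n1]
    simp [GExpr.eval, eval_twoNE hN]
  congr 1
  · rw [GStmt.out, eval_PE hN]
    refine range_flatMap_congr fun i hi => ?_
    have hN' := hN_update hN SVar.J (by decide) i
    rw [out_notsIf hN']
    refine List.flatMap_congr fun g _ => ?_
    rw [notPredN_coin M hi]
    simp [GExpr.eval, eval_twoNE hN']
  · rw [GStmt.out]
    refine range_flatMap_congr fun i _ => ?_
    have hN' := hN_update hN SVar.J (by decide) i
    rw [out_notsIf hN']
    refine List.flatMap_congr fun g _ => ?_
    rw [notPredN_ge]
    simp [GExpr.eval, eval_NwE hN']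

/-- **The negation piece generates the `NOT` stream of `initNots`.** [cite: Sipser2012, Thm. 9.30 (proof)] -/
theorem out_initNotsS (hN : env SVar.N0 = n) :
    (initNotsS M c k p).out env =
      (initNots M n Pv Tv).flatMap fun op => opTokN (op.map (num M)) := by
  rw [flatMap_initNots, initNotsS, out_seqs]
  simp only [List.flatMap_cons, List.flatMap_nil, List.append_nil]
  rw [← List.append_assoc]
  congr 1
  · congr 1
    · rw [out_seqs, List.flatMap_map]
      refine List.flatMap_congr fun l _ => ?_
      split_ifs with h
      · simp [ClOp.map, eval_labE hN, GExpr.eval]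
      · rfl
    · rw [out_seqs, List.flatMap_map]
      refine List.flatMap_congr fun v _ => ?_
      split_ifs with h
      · simp [ClOp.map, eval_varE hN, GExpr.eval, Nat.add_assoc]
      · rfl
  · rw [out_seqs, List.flatMap_map]
    refine List.flatMap_congr fun kk _ => ?_
    by_cases hk : kk = k₀' M
    · subst hk
      rw [if_pos rfl, out_notsK0S hN]
      simp only [decide_true]
    · rw [if_neg hk, out_notsOtherS hN kk hk]

/-- `cnotsIf` generates the conditional `CNOT`s into one cell. [folklore] -/
theorem out_cnotsIf (hN : env SVar.N0 = n) (j src : SimExpr) :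
    (cnotsIf M c k p j src).out env =
      (List.finRange (W M).A).flatMap fun g =>
        if g = cB M true ∨ g = cB M false then
          cnotTok (src.eval env) (cellN M n Pv Sv (k₀' M) (j.eval env) g) else [] := by
  rw [cnotsIf, out_seqs, List.flatMap_map]
  refine List.flatMap_congr fun g _ => ?_
  split_ifs with h
  · simp [ClOp.map, opTokN, eval_cell0E hN]
  · rfl

/-- `cnotsK0S` generates the `CNOT`s of block `0` on the input stack. [folklore] -/
theorem out_cnotsK0S (hN : env SVar.N0 = n) :
    (cnotsK0S M c k p).out env =
      (List.range Sv).flatMap fun j => (List.finRange (W M).A).flatMap fun g =>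
        ((initSrcN M n Pv true j g).map fun s => cnotTok s (cellN M n Pv Sv (k₀' M) j g)).getD [] := by
  rw [range_S_flatMap hN, cnotsK0S, GStmt.out, GStmt.out, GStmt.out, eval_nE hN, eval_PE hN,
    range_two_mul_flatMap]
  simp only [initSrcN_sep M (Or.inl rfl), initSrcN_sep M (Or.inr rfl), initSrcN_ge,
    Option.map_none, Option.getD_none, List.flatMap_eq_nil_iff.2 fun _ _ => rfl, List.nil_append,
    List.append_nil]
  congr 1
  · refine range_flatMap_congr fun i hi => ?_
    have hN' := hN_update hN SVar.I (by decide) i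
    rw [GStmt.out, out_cnotsIf hN', out_cnotsIf hN']
    have h1 : 2 * i < 2 * n := by omega
    have h2 : 2 * i + 1 < 2 * n := by omega
    have d1 : 2 * i / 2 = i := by omega
    have d2 : (2 * i + 1) / 2 = i := by omega
    congr 1
    · refine List.flatMap_congr fun g _ => ?_
      rw [initSrcN_lt M h1]
      by_cases hg : g = cB M true ∨ g = cB M false <;> simp [hg, GExpr.eval, d1]
    · refine List.flatMap_congr fun g _ => ?_
      rw [initSrcN_lt M h2]
      by_cases hg : g = cB M true ∨ g = cB M false <;> simp [hg, GExpr.eval, d2]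
  · refine range_flatMap_congr fun i hi => ?_
    have hN' := hN_update hN SVar.I (by decide) i
    rw [out_cnotsIf hN']
    refine List.flatMap_congr fun g _ => ?_
    rw [initSrcN_coin M hi]
    by_cases hg : g = cB M true ∨ g = cB M false <;>
      simp [hg, GExpr.eval, eval_twoNE hN', eval_nE hN']

/-- **The `CNOT` piece generates the `CNOT` stream of `initCnots`.** [folklore] -/
theorem out_initCnotsS (hN : env SVar.N0 = n) :
    (initCnotsS M c k p).out env =
      (initCnots M n Pv Tv).flatMap fun op => opTokN (op.map (num M)) := by
  rw [flatMap_initCnots, initCnotsS, out_seqs, List.flatMap_map]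
  refine List.flatMap_congr fun kk _ => ?_
  by_cases hk : kk = k₀' M
  · subst hk
    rw [if_pos rfl, out_cnotsK0S hN]
    simp only [decide_true]
  · rw [if_neg hk, GStmt.out]
    symm
    refine List.flatMap_eq_nil_iff.2 fun j _ => List.flatMap_eq_nil_iff.2 fun g _ => ?_
    simp [hk, initSrcN_false]

/-! #### Loop-index discipline of the initialisation pieces -/

/-- `notsIf` uses the index `Z` only. [folklore] -/
theorem gok_notsIf (kk : Fin (W M).κ) (j : SimExpr) (P : Fin (W M).A → Bool) :
    GOK [SVar.Z] (notsIf M c k p kk j P) :=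
  gok_seqs fun s hs => by
    obtain ⟨g, -, rfl⟩ := List.mem_map.1 hs
    exact gok_ite (gok_opS _) (gok_emit _ _)

/-- `notsK0S` uses the indices `Z, J`. [folklore] -/
theorem gok_notsK0S : GOK [SVar.Z, SVar.J] (notsK0S M c k p) :=
  gok_seqs fun s hs => by
    simp only [List.mem_cons, List.not_mem_nil, or_false] at hs
    rcases hs with rfl | rfl | rfl | rfl | rfl
    · exact gok_loop (gok_notsIf _ _ _) (by decide) (by decide) (by decide)
    · exact gok_mono (gok_notsIf _ _ _) (by decide)
    · exact gok_mono (gok_notsIf _ _ _) (by decide)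
    · exact gok_loop (gok_notsIf _ _ _) (by decide) (by decide) (by decide)
    · exact gok_loop (gok_notsIf _ _ _) (by decide) (by decide) (by decide)

/-- `notsOtherS` uses the indices `Z, J`. [folklore] -/
theorem gok_notsOtherS (kk : Fin (W M).κ) : GOK [SVar.Z, SVar.J] (notsOtherS M c k p kk) :=
  gok_loop (gok_notsIf _ _ _) (by decide) (by decide) (by decide)

/-- `initNotsS` uses the indices `Z, J`. [folklore] -/
theorem gok_initNotsS : GOK [SVar.Z, SVar.J] (initNotsS M c k p) :=
  gok_seqs fun s hs => by
    simp only [List.mem_cons, List.not_mem_nil, or_false] at hs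
    rcases hs with rfl | rfl | rfl
    · exact gok_seqs fun s hs => by
        obtain ⟨l, -, rfl⟩ := List.mem_map.1 hs
        exact gok_ite (gok_mono (gok_opS _) (by decide)) (gok_emit _ _)
    · exact gok_seqs fun s hs => by
        obtain ⟨v, -, rfl⟩ := List.mem_map.1 hs
        exact gok_ite (gok_mono (gok_opS _) (by decide)) (gok_emit _ _)
    · exact gok_seqs fun s hs => by
        obtain ⟨kk, -, rfl⟩ := List.mem_map.1 hs
        exact gok_ite gok_notsK0S (gok_notsOtherS kk)

/-- `cnotsIf` uses the index `Z` only. [folklore] -/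
theorem gok_cnotsIf (j src : SimExpr) : GOK [SVar.Z] (cnotsIf M c k p j src) :=
  gok_seqs fun s hs => by
    obtain ⟨g, -, rfl⟩ := List.mem_map.1 hs
    exact gok_ite (gok_opS _) (gok_emit _ _)

/-- `cnotsK0S` uses the indices `Z, I`. [folklore] -/
theorem gok_cnotsK0S : GOK [SVar.Z, SVar.I] (cnotsK0S M c k p) :=
  gok_seq (gok_loop (gok_seq (gok_cnotsIf _ _) (gok_cnotsIf _ _)) (by decide) (by decide) (by decide))
    (gok_loop (gok_cnotsIf _ _) (by decide) (by decide) (by decide))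

/-- `initCnotsS` uses the indices `Z, I`. [folklore] -/
theorem gok_initCnotsS : GOK [SVar.Z, SVar.I] (initCnotsS M c k p) :=
  gok_seqs fun s hs => by
    obtain ⟨kk, -, rfl⟩ := List.mem_map.1 hs
    exact gok_ite gok_cnotsK0S (gok_emit _ _)

end Init

/-! ### The generator and the uniformity theorem -/

section Assembly

variable (M : Turing.TM2ComputableAux Bool Bool) (c k : ℕ) (p : Polynomial ℕ)

/-- **The generator of the description stream** of the simulation family: header, Hadamard
coins, initialisation (`NOT`s, then `CNOT`s), tableau, final swap.
[cite: AroraBarakCC2009, Thm. 6.6 (proof), Remark 6.7] -/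
noncomputable def gen : SimStmt :=
  seqs [headerS M c k p, hadS p, initNotsS M c k p, initCnotsS M c k p, tabS M c k p, swapS M c k p]

/-- The loop indices of the generator are `Z, J, I, TT`, never reused. [folklore] -/
theorem gok_gen : GOK [SVar.Z, SVar.J, SVar.I, SVar.TT] (gen M c k p) :=
  gok_seqs fun s hs => by
    simp only [List.mem_cons, List.not_mem_nil, or_false] at hs
    rcases hs with rfl | rfl | rfl | rfl | rfl | rfl
    · exact gok_mono (gok_headerS M c k p) (by decide)
    · exact gok_mono (gok_hadS p) (by decide)
    · exact gok_mono gok_initNotsS (by decide)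
    · exact gok_mono gok_initCnotsS (by decide)
    · exact gok_mono gok_tabS (by decide)
    · exact gok_mono (gok_swapS M c k p) (by decide)

/-- The input variable is not a loop index of the generator. [folklore] -/
theorem N0_notMem_loopVars_gen : SVar.N0 ∉ (gen M c k p).loopVars := fun h => by
  have := (gok_gen M c k p).2 _ h
  simp at this

/-- **The generator generates the description of the simulation family.**
[cite: AroraBarakCC2009, Thm. 6.6 (proof), Remark 6.7] -/
theorem out_gen (n : ℕ) :
    (gen M c k p).out (GenProg.initEnv SVar.N0 n) =
      descTok n (pcF p n + simM M (tbF c k) (pcF p) n)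
        ((coinFamily (pcF p) (simM M (tbF c k) (pcF p)) (simCircuit M (tbF c k) (pcF p))).circ n) := by
  have hN : GenProg.initEnv SVar.N0 n SVar.N0 = n := GenProg.initEnv_self _ _
  rw [gen, out_seqs]
  simp only [List.flatMap_cons, List.flatMap_nil, List.append_nil]
  rw [out_headerS M c k p hN, out_hadS p hN (simM M (tbF c k) (pcF p) n), out_initNotsS hN,
    out_initCnotsS hN, out_tabS hN, out_swapS M c k p hN, descTok, circTok_mk_append,
    show (⟨(simCircuit M (tbF c k) (pcF p) n).gates⟩ : QCircuit cliffordT _) =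
      simCircuit M (tbF c k) (pcF p) n from rfl,
    circTok_simCircuit, progIdx, initOps]
  simp only [List.flatMap_append, List.append_assoc]

end Assembly

end SimGen

end BPPSim

open BPPSim in
/-- **Uniformity of the `BPP ⊆ BQP` simulation family** (discharge of the named fact
`simFamily_isUniform` of `ReversibleSimulation.lean`): the description of the family is the
stream of the generator `SimGen.gen` (`SimGen.out_gen`), and generated streams rendered in
binary are polynomial-time (`QCircuitFamily.isUniform_of_gen`, resting on
`GStmt.render_out_mem_FP`). [Arora–Barak 2009, Thm. 6.6 with Remark 6.7, Def. 6.12;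
Bernstein–Vazirani 1997, proof of Thm. 8.3] [cite: AroraBarakCC2009, Thm. 6.6, Remark 6.7, Def. 6.12] -/
theorem simFamily_isUniform_holds : simFamily_isUniform := by
  intro M tb pc c k p htb hpc
  obtain rfl : tb = SimGen.tbF c k := funext htb
  obtain rfl : pc = SimGen.pcF p := funext hpc
  exact QCircuitFamily.isUniform_of_gen _ (SimGen.gen M c k p) SVar.N0
    (SimGen.N0_notMem_loopVars_gen M c k p) (SimGen.gok_gen M c k p).1 (SimGen.out_gen M c k p)

/-- **The reversible core of `BPP ⊆ BQP`** (discharge of the named fact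
`uniformReversibleSimulation` of `BQPProofs.lean`). [cite: BernsteinVazirani1997, Thm. 8.3 (proof)] -/
theorem uniformReversibleSimulation_holds : uniformReversibleSimulation :=
  uniformReversibleSimulation_of_isUniform simFamily_isUniform_holds

/-- **`BPP ⊆ BQP`** (Bernstein–Vazirani 1997, Thm. 8.3; Arora–Barak 2009, Cor. 10.11):
discharge of the named fact `BPP_subset_BQP` of `BQP.lean`, by the reduction
`BPP_subset_BQP_of_uniformReversibleSimulation` (`BQPProofs.lean`: Hadamard coins and
acceptance counting) and the reversible core `uniformReversibleSimulation_holds` (Clifford+T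
compilation of `NOT`/`CNOT`/Toffoli, `ReversibleCliffordT.lean`; the one-hot tableau of the
window machine of a `TM2` decider, `TM2Window.lean`, `WindowTableau.lean`,
`TableauBridge.lean`, `ReversibleSimulation.lean`; polynomial-time uniformity by a counter
program, `GenPrograms.lean`, `TokenStreams.lean`, `QuantumCircuitTokens.lean`,
`SimTokens.lean`, this file). [cite: BernsteinVazirani1997, Thm. 8.3] -/
theorem BPP_subset_BQP_holds : BPP_subset_BQP :=
  BPP_subset_BQP_of_uniformReversibleSimulation uniformReversibleSimulation_holds

end Literature.Computability.QuantumComplexity
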